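import Literature.MathematicalPhysics.QuantumFieldTheory.Balaban1983to89.T4ExpWindowSmallField
import Literature.MathematicalPhysics.QuantumFieldTheory.Balaban1983to89.T4WilsonLinkAffine
import Mathlib.Analysis.SpecialFunctions.Trigonometric.Basic
import HarnessLib

/-!
# SMALL-STEP SUBDIVISION OF A ONE-BOND MOVE INSIDE THE PLAQUETTE WINDOW (LEAD-20520 w3 g24 WORD №4 (P-a)), DEFINITION-FREE

Cell `ym3-torus` (YM ladder rung R3 = continuum `SU(2)` Yang–Mills on the three-torus — a RUNG, NOT d = 4, NOT infinite volume, NOT a mass gap,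
NOT Clay).  Width seat `ym-ust-20520-w4` (gen 22); `--supports stmt-QuantumFields-20520 --as helper`, count-neutral, definition-free, default
heartbeats; no registry, binder or `Lines/` edit; the registered skeleton `Lines/semiclassical_s2beta.lean` v11.4 and its five stubs are untouched
(0∕5, ★★OWNER RULING №36).  v18-TEXT-INDEPENDENT: a piece of `SU(2)` ∕ lattice geometry for the (GR-a) telescope's `N(U) ∕ hgood ∕ path` input
(crux-dir `GROrganTelescope.firstDiff_window_path` transports a one-bond first difference along a path of RIGHT exponential one-bond moves
`U ↦ update U b (U b · expPt v)` of size `‖v‖ ≤ r·θ`, all intermediate configurations `θ`-small).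

WHAT.  §1 ★`dist1_expPoint_smul_le`: along the one-parameter subgroup through `g = expPoint x` (`x := logVec (su2Quat g)`, the GLOBAL logarithm
of lit ✓`T4ExpWindowSmallField`, `‖x‖ ≤ π`), `dist1 (expPoint (t • x)) ≤ dist1 g` for `t ∈ [0,1]` (`dist1 = 2 sin(‖·‖∕2)` and `sin` is monotone on
`[0, π∕2]`).  §2 ★★`exists_subdivision_of_dist1_le` (ANY lattice `Params`, τ-form): if `U` is `θ₁`-small and `dist1 g ≤ τ`, then for every
`δ > 0` there are `n ≥ 1`, `n ≤ π∕δ + 2`, and a coordinate vector `‖v‖ ≤ δ` with `expPt (n • v) = g`, every partial move `expPt (k • v)` (`k ≤ n`)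
within `dist1 g` of `1`, and every partially moved configuration `update U b (U b · expPt (k • v))` `(θ₁ + 4τ)`-small (lit
✓`plaqSmall_of_bdev_le`).  §3 ★★`exists_subdivision_oneBondMove` (LEAD's form): if BOTH `U` and the moved configuration `update U b (U b · g)` are
`θ₁`-small and the lattice has a second direction `ν ≠ b.dir` (automatic on `T³`), then `dist1 g < 2θ₁` (ONE plaquette through `b`: its holonomy
changes by a CONJUGATE of `g^{±1}`; torus sides are `2·L^k ≥ 2` — lit ✓`T4WilsonLinkAffine.shift_ne_self` —, so `b` occurs at most once in a plaquette boundary) and every partially moved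
configuration is `3θ₁`-small — the constant `3` of the offer, with NO chart-injectivity hypothesis (the logarithm is global).

HONEST FRAMING: lattice∕Lie-group bookkeeping; nothing of Bałaban's renormalisation-group analysis is asserted; TN-GR (v), O1∕O1ᵘ-H, the crux
`FluctuationComparisonRegPrIntL` (stmt-QuantumFields-20520) and `YM3TorusSU2` are NOT proved; no summit ∕ sub-problem statement is proved; rung R3 =
SU(2) YM₃ on T³ — NOT d = 4, NOT infinite volume, NOT a mass gap, NOT Clay; the Yang–Mills mass gap is NOT proved by any of this.
[cite: Balaban1985Averaging, (8)-(9) p.19; Balaban1987RG1, (0.18) p.255]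
-/

set_option autoImplicit false

noncomputable section

namespace Summit.QuantumFields.YangMills.Theorems.OrganTangentSmallStepOneBond

open Function
open Literature.MathematicalPhysics.QuantumFieldTheory
open Literature.MathematicalPhysics.QuantumFieldTheory.Balaban1983to89
open Literature.MathematicalPhysics.QuantumLattice (su2Quat)
open T4CubeChartGnomonic (SU2)
open T4HaarSU2ExpChart (expPoint)
open T4CubeChartExp (toE expPt expPt_zero)
open T4TiltOscillation (bdev)
open T4WilsonLinkAffine (shift_ne_self)
open T4ExpWindowSmallField (logVec expPoint_logVec norm_logVec_le_pi abs_logVec_apply_le dist1_eq_two_mul_sin dist1_expPoint_eq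
  plaqSmall_of_bdev_le dist1_plaqHol_le_add plaqDev)

/-! ## §1 One-parameter subgroups: `dist1` is monotone up to the logarithm -/

section Group

/-- Along the one-parameter subgroup through `expPoint x`, `‖x‖ ≤ π`: `dist1 (expPoint (t • x)) ≤ 2 sin(‖x‖∕2)` for `t ∈ [0,1]`
(`dist1 (expPoint y) = 2|sin(‖y‖∕2)|` and `sin` is monotone on `[0, π∕2]`). [folklore] -/
theorem dist1_expPoint_smul_le (x : EuclideanSpace ℝ (Fin 3)) (hx : ‖x‖ ≤ Real.pi) {t : ℝ} (ht0 : 0 ≤ t) (ht1 : t ≤ 1) :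
    dist1 (expPoint (t • x)) ≤ 2 * Real.sin (‖x‖ / 2) := by
  rw [dist1_expPoint_eq, norm_smul, Real.norm_eq_abs, abs_of_nonneg ht0]
  have h1 : 0 ≤ t * ‖x‖ / 2 := by positivity
  have h2 : t * ‖x‖ / 2 ≤ ‖x‖ / 2 := by nlinarith [norm_nonneg x]
  have h3 : ‖x‖ / 2 ≤ Real.pi / 2 := by linarith
  have h4 : t * ‖x‖ / 2 ≤ Real.pi := by linarith [Real.pi_pos]
  rw [abs_of_nonneg (Real.sin_nonneg_of_nonneg_of_le_pi h1 h4)]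
  exact mul_le_mul_of_nonneg_left (Real.sin_le_sin_of_le_of_le_pi_div_two (by linarith [Real.pi_pos]) h3 h2) zero_le_two

/-- `dist1 (expPoint (t • logVec g)) ≤ dist1 g` for `t ∈ [0,1]`: the partial moves along the logarithm are no farther from `1` than `g`.
[folklore] -/
theorem dist1_expPoint_smul_logVec_le (g : SU2) {t : ℝ} (ht0 : 0 ≤ t) (ht1 : t ≤ 1) :
    dist1 (expPoint (t • logVec (su2Quat g))) ≤ dist1 g := by
  rw [dist1_eq_two_mul_sin g]
  exact dist1_expPoint_smul_le _ (norm_logVec_le_pi _) ht0 ht1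

/-- The coordinates of the logarithm, as a vector of the sup-normed `Fin 3 → ℝ`, have norm `≤ ‖logVec‖ ≤ π`. [folklore] -/
theorem norm_ofLp_logVec_le (g : SU2) : ‖WithLp.ofLp (logVec (su2Quat g))‖ ≤ Real.pi := by
  refine (pi_norm_le_iff_of_nonneg Real.pi_pos.le).2 fun i => ?_
  rw [Real.norm_eq_abs]
  exact (abs_logVec_apply_le _ i).trans (norm_logVec_le_pi _)

/-- `expPt (t • coordinates of x) = expPoint (t • x)`. [folklore] -/
theorem expPt_smul_ofLp (t : ℝ) (x : EuclideanSpace ℝ (Fin 3)) : expPt (t • WithLp.ofLp x) = expPoint (t • x) := by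
  rw [expPt]
  congr 1

end Group

/-! ## §2 The subdivision of a one-bond move (τ-form, any lattice) -/

section Subdivision

variable {P : Params} {j : ℕ} [DecidableEq (PBond P j)]

/-- The bond deviations of a one-bond right move `update U b (U b · h)` from `U`: `h` at `b`, `1` elsewhere — so all `≤ dist1 h`. [folklore] -/
theorem dist1_bdev_update_le (U : GaugeField P j SU2) (b : PBond P j) (h : SU2) (e : PBond P j) :
    dist1 (bdev (update U b (U b * h)) U e) ≤ dist1 h := by
  unfold bdev
  by_cases he : e = b
  · subst he
    rw [update_self, inv_mul_cancel_left]
  · rw [update_of_ne he, inv_mul_cancel, GaugeGroup.dist1_one]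
    exact GaugeGroup.dist1_nonneg h

/-- ★★ **SMALL-STEP SUBDIVISION OF A ONE-BOND MOVE (τ-form).**  `U` `θ₁`-small, `dist1 g ≤ τ`, `δ > 0`: there are `n ≥ 1` with
`n ≤ π∕δ + 2` and `v` with `‖v‖ ≤ δ` such that `expPt (n • v) = g`, every partial move `expPt (k • v)`, `k ≤ n`, is within `dist1 g` of `1`,
and every partially moved configuration `update U b (U b · expPt (k • v))` is `(θ₁ + 4τ)`-small.  (`v := n⁻¹ •` the coordinates of the
global logarithm `logVec (su2Quat g)`, `n := ⌈π∕δ⌉₊ + 1`; lit ✓`plaqSmall_of_bdev_le`.) [cite: Balaban1985Averaging, (8)-(9) p.19] -/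
theorem exists_subdivision_of_dist1_le {θ₁ τ δ : ℝ} (U : GaugeField P j SU2) (b : PBond P j) (g : SU2)
    (hU : PlaqSmall θ₁ U) (hg : dist1 g ≤ τ) (hδ : 0 < δ) :
    ∃ (n : ℕ) (v : Fin 3 → ℝ), 0 < n ∧ (n : ℝ) ≤ Real.pi / δ + 2 ∧ ‖v‖ ≤ δ ∧ expPt ((n : ℝ) • v) = g ∧
      (∀ k : ℕ, k ≤ n → dist1 (expPt ((k : ℝ) • v)) ≤ dist1 g) ∧
      ∀ k : ℕ, k ≤ n → PlaqSmall (θ₁ + 4 * τ) (update U b (U b * expPt ((k : ℝ) • v))) := by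
  set x : EuclideanSpace ℝ (Fin 3) := logVec (su2Quat g) with hx
  set n : ℕ := ⌈Real.pi / δ⌉₊ + 1 with hn
  have hn0 : 0 < n := Nat.succ_pos _
  have hnR : (0 : ℝ) < n := by exact_mod_cast hn0
  have hceil : Real.pi / δ ≤ (⌈Real.pi / δ⌉₊ : ℝ) := Nat.le_ceil _
  have hnlt : Real.pi / δ < n := by
    rw [hn]; push_cast; linarith
  have hnle : (n : ℝ) ≤ Real.pi / δ + 2 := by
    rw [hn]; push_cast
    linarith [Nat.ceil_lt_add_one (show 0 ≤ Real.pi / δ by positivity)]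
  set w : Fin 3 → ℝ := WithLp.ofLp x with hw
  -- the partial moves, as points of the one-parameter subgroup
  have hpart : ∀ k : ℕ, expPt ((k : ℝ) • ((n : ℝ)⁻¹ • w)) = expPoint (((k : ℝ) * (n : ℝ)⁻¹) • x) := by
    intro k; rw [smul_smul, hw, expPt_smul_ofLp]
  have hdist : ∀ k : ℕ, k ≤ n → dist1 (expPt ((k : ℝ) • ((n : ℝ)⁻¹ • w))) ≤ dist1 g := by
    intro k hk
    rw [hpart]
    refine dist1_expPoint_smul_logVec_le g (by positivity) ?_
    rw [mul_inv_le_iff₀ hnR, one_mul]; exact_mod_cast hk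
  refine ⟨n, (n : ℝ)⁻¹ • w, hn0, hnle, ?_, ?_, hdist, ?_⟩
  · -- ‖v‖ ≤ δ
    rw [norm_smul, norm_inv, Real.norm_natCast, inv_mul_le_iff₀ hnR]
    have hwle : ‖w‖ ≤ Real.pi := norm_ofLp_logVec_le g
    have : Real.pi < n * δ := by rwa [div_lt_iff₀ hδ] at hnlt
    linarith
  · -- expPt (n • v) = g
    rw [smul_smul, mul_inv_cancel₀ hnR.ne', one_smul, hw, show (WithLp.ofLp x : Fin 3 → ℝ) = (1 : ℝ) • WithLp.ofLp x from (one_smul _ _).symm,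
      expPt_smul_ofLp, one_smul, hx, expPoint_logVec]
  · intro k hk
    exact plaqSmall_of_bdev_le hU fun e => (dist1_bdev_update_le U b _ e).trans ((hdist k hk).trans hg)

end Subdivision

/-! ## §3 LEAD's form: both endpoints `θ₁`-small ⇒ `dist1 g < 2θ₁` and every partial move `3θ₁`-small -/

section TwoWindows

variable {P : Params} {j : ℕ} [DecidableEq (PBond P j)]

/-- ★ **ONE PLAQUETTE THROUGH `b` READS `g` UP TO CONJUGATION**: if `U` and `update U b (U b · g)` are both `θ₁`-small and the lattice has a
direction `ν ≠ b.dir`, then `dist1 g < 2θ₁`.  (Take the plaquette at `b.src` spanned by `b.dir, ν`: `b` occurs exactly once in its boundary,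
so the moved holonomy is `conj(g)·H₀` resp. `H₀·conj(g⁻¹)`; `dist1` is conjugation- and inversion-invariant and subadditive.)
[cite: Balaban1985Averaging, (9) p.19] -/
theorem dist1_lt_two_mul_of_plaqSmall_update {θ₁ : ℝ} (U : GaugeField P j SU2) (b : PBond P j) (g : SU2)
    (hU : PlaqSmall θ₁ U) (hU' : PlaqSmall θ₁ (update U b (U b * g))) (ν : Fin P.d) (hν : ν ≠ b.dir) :
    dist1 g < 2 * θ₁ := by
  obtain ⟨s, d⟩ := b
  change ν ≠ d at hν
  rcases lt_or_gt_of_ne hν with hlt | hgt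
  · -- `ν < d`: `b = ⟨s, d⟩` is the FOURTH bond of the plaquette `⟨s, ν, d⟩`
    have e1 : (⟨s, ν⟩ : PBond P j) ≠ ⟨s, d⟩ := fun h => hν (PBond.mk.inj h).2
    have e2 : (⟨s.shift ν, d⟩ : PBond P j) ≠ ⟨s, d⟩ := fun h => shift_ne_self s ν (PBond.mk.inj h).1
    have e3 : (⟨s.shift d, ν⟩ : PBond P j) ≠ ⟨s, d⟩ := fun h => hν (PBond.mk.inj h).2
    have h0 : dist1 (U ⟨s, ν⟩ * U ⟨s.shift ν, d⟩ * (U ⟨s.shift d, ν⟩)⁻¹ * (U ⟨s, d⟩)⁻¹) < θ₁ := hU ⟨s, ν, d, hlt⟩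
    have h1 : dist1 (update U ⟨s, d⟩ (U ⟨s, d⟩ * g) ⟨s, ν⟩ * update U ⟨s, d⟩ (U ⟨s, d⟩ * g) ⟨s.shift ν, d⟩ *
        (update U ⟨s, d⟩ (U ⟨s, d⟩ * g) ⟨s.shift d, ν⟩)⁻¹ * (update U ⟨s, d⟩ (U ⟨s, d⟩ * g) ⟨s, d⟩)⁻¹) < θ₁ := hU' ⟨s, ν, d, hlt⟩
    rw [update_of_ne e1, update_of_ne e2, update_of_ne e3, update_self] at h1
    have key : (U ⟨s, ν⟩ * U ⟨s.shift ν, d⟩ * (U ⟨s.shift d, ν⟩)⁻¹ * (U ⟨s, d⟩)⁻¹)⁻¹ *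
        (U ⟨s, ν⟩ * U ⟨s.shift ν, d⟩ * (U ⟨s.shift d, ν⟩)⁻¹ * (U ⟨s, d⟩ * g)⁻¹) = U ⟨s, d⟩ * g⁻¹ * (U ⟨s, d⟩)⁻¹ := by group
    calc dist1 g = dist1 g⁻¹ := (GaugeGroup.dist1_inv g).symm
      _ = dist1 (U ⟨s, d⟩ * g⁻¹ * (U ⟨s, d⟩)⁻¹) := (GaugeGroup.dist1_conj g⁻¹ (U ⟨s, d⟩)).symm
      _ = dist1 ((U ⟨s, ν⟩ * U ⟨s.shift ν, d⟩ * (U ⟨s.shift d, ν⟩)⁻¹ * (U ⟨s, d⟩)⁻¹)⁻¹ *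
            (U ⟨s, ν⟩ * U ⟨s.shift ν, d⟩ * (U ⟨s.shift d, ν⟩)⁻¹ * (U ⟨s, d⟩ * g)⁻¹)) := by rw [key]
      _ ≤ dist1 (U ⟨s, ν⟩ * U ⟨s.shift ν, d⟩ * (U ⟨s.shift d, ν⟩)⁻¹ * (U ⟨s, d⟩)⁻¹)⁻¹ +
            dist1 (U ⟨s, ν⟩ * U ⟨s.shift ν, d⟩ * (U ⟨s.shift d, ν⟩)⁻¹ * (U ⟨s, d⟩ * g)⁻¹) := GaugeGroup.dist1_mul_le _ _
      _ < θ₁ + θ₁ := by rw [GaugeGroup.dist1_inv]; exact add_lt_add h0 h1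
      _ = 2 * θ₁ := by ring
  · -- `d < ν`: `b = ⟨s, d⟩` is the FIRST bond of the plaquette `⟨s, d, ν⟩`
    have e2 : (⟨s.shift d, ν⟩ : PBond P j) ≠ ⟨s, d⟩ := fun h => hν (PBond.mk.inj h).2
    have e3 : (⟨s.shift ν, d⟩ : PBond P j) ≠ ⟨s, d⟩ := fun h => shift_ne_self s ν (PBond.mk.inj h).1
    have e4 : (⟨s, ν⟩ : PBond P j) ≠ ⟨s, d⟩ := fun h => hν (PBond.mk.inj h).2
    have h0 : dist1 (U ⟨s, d⟩ * U ⟨s.shift d, ν⟩ * (U ⟨s.shift ν, d⟩)⁻¹ * (U ⟨s, ν⟩)⁻¹) < θ₁ := hU ⟨s, d, ν, hgt⟩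
    have h1 : dist1 (update U ⟨s, d⟩ (U ⟨s, d⟩ * g) ⟨s, d⟩ * update U ⟨s, d⟩ (U ⟨s, d⟩ * g) ⟨s.shift d, ν⟩ *
        (update U ⟨s, d⟩ (U ⟨s, d⟩ * g) ⟨s.shift ν, d⟩)⁻¹ * (update U ⟨s, d⟩ (U ⟨s, d⟩ * g) ⟨s, ν⟩)⁻¹) < θ₁ := hU' ⟨s, d, ν, hgt⟩
    rw [update_self, update_of_ne e2, update_of_ne e3, update_of_ne e4] at h1
    have key : (U ⟨s, d⟩ * g * U ⟨s.shift d, ν⟩ * (U ⟨s.shift ν, d⟩)⁻¹ * (U ⟨s, ν⟩)⁻¹) *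
        (U ⟨s, d⟩ * U ⟨s.shift d, ν⟩ * (U ⟨s.shift ν, d⟩)⁻¹ * (U ⟨s, ν⟩)⁻¹)⁻¹ = U ⟨s, d⟩ * g * (U ⟨s, d⟩)⁻¹ := by group
    calc dist1 g = dist1 (U ⟨s, d⟩ * g * (U ⟨s, d⟩)⁻¹) := (GaugeGroup.dist1_conj g (U ⟨s, d⟩)).symm
      _ = dist1 ((U ⟨s, d⟩ * g * U ⟨s.shift d, ν⟩ * (U ⟨s.shift ν, d⟩)⁻¹ * (U ⟨s, ν⟩)⁻¹) *
            (U ⟨s, d⟩ * U ⟨s.shift d, ν⟩ * (U ⟨s.shift ν, d⟩)⁻¹ * (U ⟨s, ν⟩)⁻¹)⁻¹) := by rw [key]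
      _ ≤ dist1 (U ⟨s, d⟩ * g * U ⟨s.shift d, ν⟩ * (U ⟨s.shift ν, d⟩)⁻¹ * (U ⟨s, ν⟩)⁻¹) +
            dist1 (U ⟨s, d⟩ * U ⟨s.shift d, ν⟩ * (U ⟨s.shift ν, d⟩)⁻¹ * (U ⟨s, ν⟩)⁻¹)⁻¹ := GaugeGroup.dist1_mul_le _ _
      _ < θ₁ + θ₁ := by rw [GaugeGroup.dist1_inv]; exact add_lt_add h1 h0
      _ = 2 * θ₁ := by ring

/-- A bond occurs AT MOST ONCE in a plaquette boundary (torus sides `≥ 2`), so the plaquette deviation of a one-bond move `update U b (U b · h)`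
from `U` is `≤ dist1 h` (not merely `≤ 4·dist1 h`). [cite: Balaban1985Averaging, (9) p.19] -/
theorem plaqDev_update_le (U : GaugeField P j SU2) (b : PBond P j) (h : SU2) (p : Plaq P j) :
    plaqDev (update U b (U b * h)) U p ≤ dist1 h := by
  have hd0 : 0 ≤ dist1 h := GaugeGroup.dist1_nonneg h
  -- each of the four deviations: `dist1 h` if the bond is `b`, else `0`
  have val : ∀ e : PBond P j, dist1 (bdev (update U b (U b * h)) U e) = if e = b then dist1 h else 0 := by
    intro e
    unfold bdev
    by_cases he : e = b
    · subst he; rw [if_pos rfl, update_self, inv_mul_cancel_left]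
    · rw [if_neg he, update_of_ne he, inv_mul_cancel, GaugeGroup.dist1_one]
  unfold plaqDev
  rw [val, val, val, val]
  obtain ⟨s, μ, ν, hμν⟩ := p
  have hne : μ ≠ ν := hμν.ne
  -- the same-direction pairs are distinct bonds; different-direction bonds cannot both be `b`
  have h13 : (⟨s, μ⟩ : PBond P j) ≠ ⟨s.shift ν, μ⟩ := fun h => shift_ne_self s ν (PBond.mk.inj h).1.symm
  have h24 : (⟨s.shift μ, ν⟩ : PBond P j) ≠ ⟨s, ν⟩ := fun h => shift_ne_self s μ (PBond.mk.inj h).1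
  by_cases hb1 : (⟨s, μ⟩ : PBond P j) = b
  · have hb3 : (⟨s.shift ν, μ⟩ : PBond P j) ≠ b := fun h => h13 (hb1.trans h.symm)
    have hb2 : (⟨s.shift μ, ν⟩ : PBond P j) ≠ b := fun h => hne (PBond.mk.inj (hb1.trans h.symm)).2
    have hb4 : (⟨s, ν⟩ : PBond P j) ≠ b := fun h => hne (PBond.mk.inj (hb1.trans h.symm)).2
    simp only [hb1, hb2, hb3, hb4, if_true, if_false, add_zero]
    exact le_rfl
  · by_cases hb3 : (⟨s.shift ν, μ⟩ : PBond P j) = b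
    · have hb2 : (⟨s.shift μ, ν⟩ : PBond P j) ≠ b := fun h => hne (PBond.mk.inj (hb3.trans h.symm)).2
      have hb4 : (⟨s, ν⟩ : PBond P j) ≠ b := fun h => hne (PBond.mk.inj (hb3.trans h.symm)).2
      simp only [hb1, hb2, hb3, hb4, if_true, if_false, add_zero, zero_add]
      exact le_rfl
    · by_cases hb2 : (⟨s.shift μ, ν⟩ : PBond P j) = b
      · have hb4 : (⟨s, ν⟩ : PBond P j) ≠ b := fun h => h24 (hb2.trans h.symm)
        simp only [hb1, hb2, hb3, hb4, if_true, if_false, add_zero, zero_add]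
        exact le_rfl
      · by_cases hb4 : (⟨s, ν⟩ : PBond P j) = b
        · simp only [hb1, hb2, hb3, hb4, if_true, if_false, add_zero, zero_add]
          exact le_rfl
        · simp only [hb1, hb2, hb3, hb4, if_false, add_zero]
          exact hd0

/-- ★★ **SMALL-STEP SUBDIVISION OF A ONE-BOND MOVE INSIDE THE WINDOW (LEAD's form).**  If `U` and `update U b (U b · g)` are both `θ₁`-small and
the lattice has a direction `ν ≠ b.dir` (on `T³`: always), then for every `δ > 0` there are `n ≥ 1`, `n ≤ π∕δ + 2`, and `‖v‖ ≤ δ` with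
`expPt (n • v) = g` and EVERY partially moved configuration `update U b (U b · expPt (k • v))`, `k ≤ n`, `3θ₁`-small (`dist1 g < 2θ₁` by the
one-plaquette lemma, one occurrence of `b` per plaquette by `plaqDev_update_le`).  No chart-injectivity hypothesis: the logarithm is global.
[cite: Balaban1985Averaging, (8)-(9) p.19; Balaban1987RG1, (0.18) p.255] -/
theorem exists_subdivision_oneBondMove {θ₁ δ : ℝ} (U : GaugeField P j SU2) (b : PBond P j) (g : SU2)
    (hU : PlaqSmall θ₁ U) (hU' : PlaqSmall θ₁ (update U b (U b * g))) (ν : Fin P.d) (hν : ν ≠ b.dir) (hδ : 0 < δ) :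
    ∃ (n : ℕ) (v : Fin 3 → ℝ), 0 < n ∧ (n : ℝ) ≤ Real.pi / δ + 2 ∧ ‖v‖ ≤ δ ∧ expPt ((n : ℝ) • v) = g ∧
      (∀ k : ℕ, k ≤ n → dist1 (expPt ((k : ℝ) • v)) ≤ dist1 g) ∧
      ∀ k : ℕ, k ≤ n → PlaqSmall (3 * θ₁) (update U b (U b * expPt ((k : ℝ) • v))) := by
  have hg2 : dist1 g < 2 * θ₁ := dist1_lt_two_mul_of_plaqSmall_update U b g hU hU' ν hν
  obtain ⟨n, v, hn0, hnle, hv, hng, hdist, -⟩ := exists_subdivision_of_dist1_le U b g hU le_rfl hδ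
  refine ⟨n, v, hn0, hnle, hv, hng, hdist, fun k hk p => ?_⟩
  calc dist1 (GaugeField.plaqHol (update U b (U b * expPt ((k : ℝ) • v))) p)
      ≤ dist1 (GaugeField.plaqHol U p) + plaqDev (update U b (U b * expPt ((k : ℝ) • v))) U p := dist1_plaqHol_le_add _ _ p
    _ ≤ dist1 (GaugeField.plaqHol U p) + dist1 (expPt ((k : ℝ) • v)) := add_le_add le_rfl (plaqDev_update_le U b _ p)
    _ < θ₁ + 2 * θ₁ := add_lt_add_of_lt_of_le (hU p) ((hdist k hk).trans hg2.le)
    _ = 3 * θ₁ := by ring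

end TwoWindows

end Summit.QuantumFields.YangMills.Theorems.OrganTangentSmallStepOneBond

end
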